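import Summits.BirchSwinnertonDyer.BirchSwinnertonDyer.Theses.ShadowIsolation
import Summits.BirchSwinnertonDyer.BirchSwinnertonDyer.Theorems.ShadowIsolationIsolationOfAccidentalZerosStubDepthRigidity
import Summits.BirchSwinnertonDyer.BirchSwinnertonDyer.Theorems.ShadowIsolationShaCotorsionReducibleFRatReduction

/-!
# Crux `ShaCotorsionReducible` (stmt-BirchSwinnertonDyer-15277) — line `eisenstein-shadow`
# (`Cruxes/ShaCotorsionReducible/Lines/eisenstein_shadow.lean`; crux-strategist b1 2026-08-17,
# RESHAPED by lead c4 2026-08-17, v3: I_red cut by compactness AND F_red split rational / irrational,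
# exactly as crux #2's line `birth` — 5 stubs + kernel-checked composition)

Route `ShadowIsolation` (route-BirchSwinnertonDyer-ShadowIsolation), crux #7 = the RESIDUAL EISENSTEIN
SECTOR `R`: for `W/ℚ` globally minimal elliptic and a prime `p ≥ 5` of good ordinary reduction at which
`E[p]` is REDUCIBLE (a rational `p`-isogeny), `corank_{ℤ_p} Ш(E/ℚ)[p^∞] = 0` (`W.shaCorank p = 0`). The
crux is FIXED (decl `…Theses.ShadowIsolation.ShaCotorsionReducible`).

## Line `eisenstein-shadow` — the route's own shadow/isolation mechanism transferred INTO the sector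

The route proves `Ш[p^∞]`-cotorsion on the IRREDUCIBLE sector by contradiction: a positive corank gives
Ш-classes of every exact order `p^n` (support item `ShaUnboundedOfCorank`, proved inline in `closes`),
each casts an ACCIDENTAL ZERO at depth `n` — an even-sign newform `g ≠ f_W` of squarefree coprime level
raising `N_W·M`, depth-`n` congruent to `W`, with `Λ(g,1) = 0` (crux #3 `PhantomShadow`, "S") — and
accidental zeros do not exist at depth `≥ n₀(W,p)` (crux #2 `IsolationOfAccidentalZeros`, "I"). This
line asks for S only BEYOND THE EISENSTEIN DEPTH (S_red: a class of exact order `p^(n+e)` casts an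
accidental zero at depth `n`) and for I verbatim on the reducible sector (I_red), and composes them by the
route's own contrapositive (`shaCorank_eq_zero_of_shadow_of_isolation`, real proof).

## Reshape (lead c4, v3): I_red = modularity + finiteness at one depth; finiteness = rational ∪ irrational

* Depth rigidity K is a tree theorem with NO hypothesis on the sector (`Theorems.stub_depthRigidity`,
  landed for crux #2): given modularity, a fixed newform with `q`-expansion `≠ (aₘ(W))ₘ` is congruent to
  `W` only to bounded depth. Hence `isolationReducible_of : modularity → F_red → I_red` (PROVED below,
  compactness; conversely I_red ⇒ F_red with the empty set), F_red = "the accidental-zero data are finite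
  at ONE depth".
* F_red = F_rat_red ∪ F_irr_red by integrality of the `q`-expansion (`finiteShadowsAtOneDepthReducible_of`,
  PROVED below). F_rat_red is a tree theorem MODULO two statements
  (`Theorems.finiteRationalShadowsReducible_of_deepCongruenceFiniteReducible`, p156592): the
  Eichler–Shimura construction (X-stub `stub_eichlerShimura` = the Literature named fact
  `eichlerShimuraConstruction`) and the reducible-sector deep-congruence finiteness
  `stub_deepCongruenceFiniteReducible` (DC_red) — NOT a named fact: its irreducible analogue
  `DeepCongruenceFinite` (Carayol + Faltings) consumes irreducibility through Carayol's theorem; DC_red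
  is TRUE ON PAPER at depth 2 (lead c4, evidence `FRed-analysis.md` v2: equality of traces mod `p²` on
  `ker ψ₁ ∩ ker ψ₂` pins `E'[p] ≅ W[p]` and then `E'[p²]` up to the unipotent group `1 + p𝔽_pE₁₂`, so
  `E'` lies on a fixed twist of `X(p²)/Γ̄ → X₁(p²)`, genus `≥ 12`, Faltings) but not in print, so it is a
  genuine stub (formalisation XL: mod-`p²` Galois representations of elliptic curves + these modular
  curves + Faltings).
* The OPEN cores are `stub_irrationalShadowsFiniteReducible` (F_irr_red — a new non-vanishing /
  finiteness conjecture in the squarefree-level aspect, the twin of crux #2's F_irr) and the load-bearing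
  `stub_shadowBeyondEisensteinDepth` (S_red — by the landed
  `Theorems.shaCotorsionReducible_iff_shadow_of_isolation`, p155687, S_red is crux-EQUIVALENT modulo
  I_red; its only non-vacuous content is "a divisible `Ш[p^∞]` at an Eisenstein prime casts an even-sign
  accidental zero at every depth" — deep sign-kept visibility; crux idea `Ideas/eisenstein-absorption.md`
  proposes S_red = DeepVisibilityRed ∘ absorption (abstract lemma proved there) ∘ Kato).

Stubs (5 ≤ stubs_max 7): `stub_shadowBeyondEisensteinDepth` (S_red, open), `stub_irrationalShadowsFiniteReducible`
(F_irr_red, open), `stub_deepCongruenceFiniteReducible` (DC_red, true on paper, unformalised),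
`stub_modularity` (X: `exists_isNewformOf`, BCDT), `stub_eichlerShimura` (X: `eichlerShimuraConstruction`,
Knapp 11.74 + Carayol). Composition: `ShaCotorsionReducible_of_stubs : Sig.S_red → Sig.stub_modularity →
Sig.stub_eichlerShimura → Sig.stub_deepCongruenceFiniteReducible → Sig.stub_irrationalShadowsFiniteReducible → crux`
BY NAME (the only theorem with hypotheses concluding the crux by name, as `#h21_check_skeleton`
requires); `#print axioms` = `propext`, `Classical.choice`, `Quot.sound`; `ShaCotorsionReducible_skeleton`
applies it to the five stubs (the only sorries).

Disproof used (re-read 2026-08-17T11:15Z): `Cruxes/ShaCotorsionReducible/Disproof.lean` v2 (cdisprove): NO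
`_false_without_<H>` theorem is possible (R ⇐ SelmerRankShaPFinite uniformly in every hypothesis), so no
stub must consume a particular sector hypothesis (DC_red genuinely uses good ORDINARY reduction: it forces
`χ|_{I_p} = ω^{±1}`, `χ² ≠ 1`); §6 independently certifies "crux ⇒ S_red vacuously"; §7 Targets empty at
v2 — the STUCK list is S_red, F_irr_red (and DC_red for a formaliser); landed negatives
`Theorems/ShaCotorsionReducible/Negative/SectorNonempty.lean`, `…/PositiveRankMember.lean` are non-vacuity
results, nothing to import into a positive proof. Dead lines: none (`birth` superseded, not dead).
-/

-- D-0017: single-problem summit, so `Summit.BirchSwinnertonDyer.BirchSwinnertonDyer.…` repeats a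
-- namespace BY DESIGN.
set_option linter.dupNamespace false

namespace Summit.BirchSwinnertonDyer.BirchSwinnertonDyer.Cruxes.ShaCotorsionReducible.EisensteinShadow

open scoped BigOperators Topology Classical
open Filter Set Function
open Literature
open Summit.BirchSwinnertonDyer.BirchSwinnertonDyer.Theses.ShadowIsolation

/-! ## §1 Statements (plain `Prop`s over tree vocabulary; `Sig.stub_<name>` ≡ the signature of `stub_<name>`) -/

/-- **Statement of S_red** (`stub_shadowBeyondEisensteinDepth`): on the Eisenstein sector there is an
Eisenstein depth `e` beyond which a Ш-class of exact order `p^(n+e)` casts an even-sign accidental zero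
at depth `n` (matrix verbatim from cruxes #2/#3 of the route). -/
def Sig.stub_shadowBeyondEisensteinDepth : Prop :=
  ∀ (W : WeierstrassCurve ℚ) [W.IsElliptic] [W.IsGloballyMinimal] (p : ℕ) [Fact p.Prime], 5 ≤ p → W.HasGoodReductionAtPrime p → ¬ (p : ℤ) ∣ W.frobeniusTrace p → ¬ W.HasIrreducibleModPGaloisRep p → ∃ e : ℕ, ∀ n : ℕ, 1 ≤ n → (∃ σ : W.sha, addOrderOf σ = p ^ (n + e)) → ∃ (M : ℕ) (_ : NeZero (W.conductorNorm ℤ * M)) (g : CuspForm (CongruenceSubgroup.Gamma0 (W.conductorNorm ℤ * M)) 2) (R : Subring ℂ) (φ : R →+* ZMod (p ^ n)) (hR : ∀ ℓ : ℕ, ℓ.Prime → ¬ ℓ ∣ W.conductorNorm ℤ * M → Literature.NumberTheory.EllipticCurves.ModularForms.heckeEigenvalue g ℓ ∈ R), Squarefree M ∧ Nat.Coprime M (p * W.conductorNorm ℤ) ∧ Literature.NumberTheory.EllipticCurves.ModularForms.IsNewform0 g ∧ (∃ m : ℕ, (UpperHalfPlane.qExpansion 1 ⇑g).coeff m ≠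 ((W.LFunction m : ℤ) : ℂ)) ∧ Literature.NumberTheory.EllipticCurves.ModularForms.cuspHeckeOperatorₗ (CongruenceSubgroup.Gamma0 (W.conductorNorm ℤ * M)) 2 (Literature.NumberTheory.EllipticCurves.ModularForms.slToGLPos ModularGroup.S * Literature.NumberTheory.EllipticCurves.ModularForms.diagGL ((W.conductorNorm ℤ * M : ℕ) : ℚ) 1 (Nat.cast_pos.mpr (NeZero.pos (W.conductorNorm ℤ * M))) one_pos) g = -g ∧ (∀ (ℓ : ℕ) (hℓ : ℓ.Prime) (hℓL : ¬ ℓ ∣ W.conductorNorm ℤ * M), φ ⟨Literature.NumberTheory.EllipticCurves.ModularForms.heckeEigenvalue g ℓ, hR ℓ hℓ hℓL⟩ = ((W.frobeniusTrace ℓ : ℤ) : ZMod (p ^ n))) ∧ ∃ Λ : ℂ → ℂ, Differentiable ℂ Λ ∧ (∀ s : ℂ, 2 < s.re → Λ s = LSeries (fun m ↦ (UpperHalfPlane.qExpansion 1 ⇑g).coeff m) s) ∧ Λ 1 = 0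

/-- **Statement of I_red** (isolation of accidental zeros on the Eisenstein sector — crux #2
`IsolationOfAccidentalZeros` with `E[p]` REDUCIBLE in place of irreducible). Not a stub: DERIVED from
modularity and F_red by `isolationReducible_of`. -/
def Sig.isolationReducible : Prop :=
  ∀ (W : WeierstrassCurve ℚ) [W.IsElliptic] [W.IsGloballyMinimal] (p : ℕ) [Fact p.Prime], 5 ≤ p → W.HasGoodReductionAtPrime p → ¬ (p : ℤ) ∣ W.frobeniusTrace p → ¬ W.HasIrreducibleModPGaloisRep p → ∃ n₀ : ℕ, ∀ n : ℕ, n₀ ≤ n → ¬ ∃ (M : ℕ) (_ : NeZero (W.conductorNorm ℤ * M)) (g : CuspForm (CongruenceSubgroup.Gamma0 (W.conductorNorm ℤ * M)) 2) (R : Subring ℂ) (φ : R →+* ZMod (p ^ n)) (hR : ∀ ℓ : ℕ, ℓ.Prime → ¬ ℓ ∣ W.conductorNorm ℤ * M → Literature.NumberTheory.EllipticCurves.ModularForms.heckeEigenvalue g ℓ ∈ R), Squarefree M ∧ Nat.Coprime M (p * W.conductorNorm ℤ) ∧ Literature.NumberTheory.EllipticCurves.ModularForms.IsNewform0 g ∧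 (∃ m : ℕ, (UpperHalfPlane.qExpansion 1 ⇑g).coeff m ≠ ((W.LFunction m : ℤ) : ℂ)) ∧ Literature.NumberTheory.EllipticCurves.ModularForms.cuspHeckeOperatorₗ (CongruenceSubgroup.Gamma0 (W.conductorNorm ℤ * M)) 2 (Literature.NumberTheory.EllipticCurves.ModularForms.slToGLPos ModularGroup.S * Literature.NumberTheory.EllipticCurves.ModularForms.diagGL ((W.conductorNorm ℤ * M : ℕ) : ℚ) 1 (Nat.cast_pos.mpr (NeZero.pos (W.conductorNorm ℤ * M))) one_pos) g = -g ∧ (∀ (ℓ : ℕ) (hℓ : ℓ.Prime) (hℓL : ¬ ℓ ∣ W.conductorNorm ℤ * M), φ ⟨Literature.NumberTheory.EllipticCurves.ModularForms.heckeEigenvalue g ℓ, hR ℓ hℓ hℓL⟩ = ((W.frobeniusTrace ℓ : ℤ) : ZMod (p ^ n))) ∧ ∃ Λ : ℂ → ℂ, Differentiable ℂ Λ ∧ (∀ s : ℂ, 2 < s.re → Λ s = LSeries (fun m ↦ (UpperHalfPlane.qExpansion 1 ⇑g).coeff m) s) ∧ Λ 1 = 0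

/-- **Statement of F_red** (finiteness at ONE depth of the accidental-zero data on the Eisenstein sector).
Not a stub after v3: DERIVED from F_rat_red (Eichler–Shimura + DC_red) and F_irr_red by
`finiteShadowsAtOneDepthReducible_of`. -/
def Sig.finiteShadowsAtOneDepthReducible : Prop :=
  ∀ (W : WeierstrassCurve ℚ) [W.IsElliptic] [W.IsGloballyMinimal] (p : ℕ) [Fact p.Prime], 5 ≤ p → W.HasGoodReductionAtPrime p → ¬ (p : ℤ) ∣ W.frobeniusTrace p → ¬ W.HasIrreducibleModPGaloisRep p → ∃ n : ℕ, Set.Finite {x : Σ M : ℕ, CuspForm (CongruenceSubgroup.Gamma0 (W.conductorNorm ℤ * M)) 2 | ∃ (_ : NeZero (W.conductorNorm ℤ * x.1)) (R : Subring ℂ) (φ : R →+* ZMod (p ^ n)) (hR : ∀ ℓ : ℕ, ℓ.Prime → ¬ ℓ ∣ W.conductorNorm ℤ * x.1 → Literature.NumberTheory.EllipticCurves.ModularForms.heckeEigenvalue x.2 ℓ ∈ R), Squarefree x.1 ∧ Nat.Coprime x.1 (p * W.conductorNorm ℤ) ∧ Literature.NumberTheory.EllipticCurves.ModularForms.IsNewform0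 x.2 ∧ (∃ m : ℕ, (UpperHalfPlane.qExpansion 1 ⇑(x.2)).coeff m ≠ ((W.LFunction m : ℤ) : ℂ)) ∧ Literature.NumberTheory.EllipticCurves.ModularForms.cuspHeckeOperatorₗ (CongruenceSubgroup.Gamma0 (W.conductorNorm ℤ * x.1)) 2 (Literature.NumberTheory.EllipticCurves.ModularForms.slToGLPos ModularGroup.S * Literature.NumberTheory.EllipticCurves.ModularForms.diagGL ((W.conductorNorm ℤ * x.1 : ℕ) : ℚ) 1 (Nat.cast_pos.mpr (NeZero.pos (W.conductorNorm ℤ * x.1))) one_pos) x.2 = -(x.2) ∧ (∀ (ℓ : ℕ) (hℓ : ℓ.Prime) (hℓL : ¬ ℓ ∣ W.conductorNorm ℤ * x.1), φ ⟨Literature.NumberTheory.EllipticCurves.ModularForms.heckeEigenvalue x.2 ℓ, hR ℓ hℓ hℓL⟩ = ((W.frobeniusTrace ℓ : ℤ) : ZMod (p ^ n))) ∧ ∃ Λ : ℂ → ℂ, Differentiable ℂ Λ ∧ (∀ s : ℂ, 2 < s.re → Λ s = LSeries (fun m ↦ (UpperHalfPlane.qExpansion 1 ⇑(x.2)).coeff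 m) s) ∧ Λ 1 = 0}

/-- **Statement of F_irr_red** (`stub_irrationalShadowsFiniteReducible`): on the Eisenstein sector there is
a depth `n` at which the accidental-zero data `(M, g)` whose newform `g` does NOT have an integral
`q`-expansion form a finite set (crux #2's `stub_irrationalShadowsFinite` with `E[p]` reducible). -/
def Sig.stub_irrationalShadowsFiniteReducible : Prop :=
  ∀ (W : WeierstrassCurve ℚ) [W.IsElliptic] [W.IsGloballyMinimal] (p : ℕ) [Fact p.Prime], 5 ≤ p → W.HasGoodReductionAtPrime p → ¬ (p : ℤ) ∣ W.frobeniusTrace p → ¬ W.HasIrreducibleModPGaloisRep p → ∃ n : ℕ, Set.Finite {x : Σ M : ℕ, CuspForm (CongruenceSubgroup.Gamma0 (W.conductorNorm ℤ * M)) 2 | ∃ (_ : NeZero (W.conductorNorm ℤ * x.1)) (R : Subring ℂ) (φ : R →+* ZMod (p ^ n)) (hR : ∀ ℓ : ℕ, ℓ.Prime → ¬ ℓ ∣ W.conductorNorm ℤ * x.1 → Literature.NumberTheory.EllipticCurves.ModularForms.heckeEigenvalue x.2 ℓ ∈ R), ¬ (∀ m : ℕ, ∃ a : ℤ, (UpperHalfPlane.qExpansion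 1 ⇑(x.2)).coeff m = (a : ℂ)) ∧ Squarefree x.1 ∧ Nat.Coprime x.1 (p * W.conductorNorm ℤ) ∧ Literature.NumberTheory.EllipticCurves.ModularForms.IsNewform0 x.2 ∧ (∃ m : ℕ, (UpperHalfPlane.qExpansion 1 ⇑(x.2)).coeff m ≠ ((W.LFunction m : ℤ) : ℂ)) ∧ Literature.NumberTheory.EllipticCurves.ModularForms.cuspHeckeOperatorₗ (CongruenceSubgroup.Gamma0 (W.conductorNorm ℤ * x.1)) 2 (Literature.NumberTheory.EllipticCurves.ModularForms.slToGLPos ModularGroup.S * Literature.NumberTheory.EllipticCurves.ModularForms.diagGL ((W.conductorNorm ℤ * x.1 : ℕ) : ℚ) 1 (Nat.cast_pos.mpr (NeZero.pos (W.conductorNorm ℤ * x.1))) one_pos) x.2 = -(x.2) ∧ (∀ (ℓ : ℕ) (hℓ : ℓ.Prime) (hℓL : ¬ ℓ ∣ W.conductorNorm ℤ * x.1), φ ⟨Literature.NumberTheory.EllipticCurves.ModularForms.heckeEigenvalue x.2 ℓ, hR ℓ hℓ hℓL⟩ = ((W.frobeniusTrace ℓ : ℤ) : ZMod (p ^ n)))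 ∧ ∃ Λ : ℂ → ℂ, Differentiable ℂ Λ ∧ (∀ s : ℂ, 2 < s.re → Λ s = LSeries (fun m ↦ (UpperHalfPlane.qExpansion 1 ⇑(x.2)).coeff m) s) ∧ Λ 1 = 0}

/-- **Statement of DC_red** (`stub_deepCongruenceFiniteReducible`): on the Eisenstein sector there is a
depth `n` at which the `L`-coefficient systems of elliptic curves `E'/ℚ` with `a_ℓ(E') ≡ a_ℓ(W) (mod pⁿ)`
for all but finitely many primes `ℓ` form a finite set (the reducible-sector analogue of the Literature
fact `DeepCongruenceFinite`; verbatim the hypothesis of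
`Theorems.finiteRationalShadowsReducible_of_deepCongruenceFiniteReducible`). -/
def Sig.stub_deepCongruenceFiniteReducible : Prop :=
  ∀ (W : WeierstrassCurve ℚ) [W.IsElliptic] [W.IsGloballyMinimal] (p : ℕ) [Fact p.Prime], 5 ≤ p → W.HasGoodReductionAtPrime p → ¬ (p : ℤ) ∣ W.frobeniusTrace p → ¬ W.HasIrreducibleModPGaloisRep p → ∃ n : ℕ, Set.Finite {a : ℕ → ℤ | ∃ (W' : WeierstrassCurve ℚ) (_ : W'.IsElliptic), (∀ m : ℕ, a m = W'.LFunction m) ∧ {ℓ : ℕ | ℓ.Prime ∧ ¬ ((p : ℤ) ^ n ∣ W'.LFunction ℓ - W.LFunction ℓ)}.Finite}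

/-- **Statement of X_mod** (`stub_modularity`): the Modularity Theorem, existence half, as the Literature
named fact `exists_isNewformOf` (BCDT 2001 Thm. A; Diamond–Shurman Thm. 8.8.3). -/
def Sig.stub_modularity : Prop :=
  Literature.NumberTheory.EllipticCurves.ModularForms.exists_isNewformOf

/-- **Statement of X_ES** (`stub_eichlerShimura`): the Eichler–Shimura construction as the Literature
named fact `eichlerShimuraConstruction` (Knapp 1993 Thm. 11.74 with Carayol; Diamond–Shurman §6.6). -/
def Sig.stub_eichlerShimura : Prop :=
  Literature.NumberTheory.EllipticCurves.ModularForms.eichlerShimuraConstruction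

/-! ## §2 Stubs (registered; `sorry` only here; statements INLINED = the registered signatures) -/

/-- **Stub S_red — shadow beyond the Eisenstein depth (load-bearing; OPEN, research).** For `W/ℚ`
globally minimal elliptic and `p ≥ 5` good ordinary with `E[p]` reducible there is `e : ℕ` such that for
every `n ≥ 1`, a class in `Ш(W/ℚ)` of exact order `p^(n+e)` forces an ACCIDENTAL ZERO AT DEPTH `n`: a
newform `g ∈ S₂(Γ₀(N_W·M))`, `M` squarefree and coprime to `p·N_W`, `q`-expansion `≠ (aₘ(W))ₘ`, Fricke
`w g = -g` (sign `+1`), depth-`n` congruent to `W` at all `ℓ ∤ N_W·M`, whose `L`-series has an entire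
continuation vanishing at `s = 1`. Why plausibly true (mechanism, none of it a theorem at an Eisenstein
prime): level-raise `f_W` modulo `p^(n+e)` at two admissible primes keeping the sign (Diamond–Taylor /
Bertolini–Darmon in the irreducible case; for residually reducible `ρ̄` non-optimal levels exist by
Yoo 2019 / Deo 2025 and the deformation theory is Wake–Wang-Erickson's), make the class visible in
`(E × A_g)/Δ` (Cremona–Mazur, Agashe–Stein Thm. 3.1, Jetchev–Stein Thm. 5.1.3 at depth 1), and note
that Eisenstein torsion / component groups of `A_g` absorb at most `p^e` of it (`f_W ≢` Eisenstein mod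
`p^(e+1)`), leaving a point of infinite order on `A_g`, whence `Λ(g,1) = 0` by Kato, Astérisque 295,
Cor. 14.3. Why it might fail: no sign-kept visibility theorem exists even at depth 1 in the irreducible
case, and at an Eisenstein maximal ideal Ihara / multiplicity one / Gorenstein-ness fail in general
(Mazur 1977 prime level; Wake–Wang-Erickson squarefree level), so "absorb at most `p^e`" is a guess.
Size: XL (open). Implied by the crux (finite `Ш[p^∞]` ⇒ vacuous for large `e`; kernel-checked as
`Theorems.shadowBeyondEisensteinDepth_of_shaCotorsionReducible`, lead c4): content = divisible Ш only.
[cite: CremonaMazur2000] [cite: AgasheStein2002, Thm. 3.1] [cite: JetchevStein2007, Thm. 5.1.3]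
[cite: Kato2004Asterisque, Cor. 14.3] [cite: doi:10.1090/tran/7314] [cite: doi:10.1016/j.aim.2024.110074]
[cite: doi:10.1016/j.aim.2020.107543] [cite: Mazur1977] -/
theorem stub_shadowBeyondEisensteinDepth : ∀ (W : WeierstrassCurve ℚ) [W.IsElliptic] [W.IsGloballyMinimal] (p : ℕ) [Fact p.Prime], 5 ≤ p → W.HasGoodReductionAtPrime p → ¬ (p : ℤ) ∣ W.frobeniusTrace p → ¬ W.HasIrreducibleModPGaloisRep p → ∃ e : ℕ, ∀ n : ℕ, 1 ≤ n → (∃ σ : W.sha, addOrderOf σ = p ^ (n + e)) → ∃ (M : ℕ) (_ : NeZero (W.conductorNorm ℤ * M)) (g : CuspForm (CongruenceSubgroup.Gamma0 (W.conductorNorm ℤ * M)) 2) (R : Subring ℂ) (φ : R →+* ZMod (p ^ n)) (hR : ∀ ℓ : ℕ, ℓ.Prime → ¬ ℓ ∣ W.conductorNorm ℤ * M → Literature.NumberTheory.EllipticCurves.ModularForms.heckeEigenvalue g ℓ ∈ R), Squarefree M ∧ Nat.Coprime M (p * W.conductorNorm ℤ) ∧ Literature.NumberTheory.EllipticCurves.ModularForms.IsNewform0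 g ∧ (∃ m : ℕ, (UpperHalfPlane.qExpansion 1 ⇑g).coeff m ≠ ((W.LFunction m : ℤ) : ℂ)) ∧ Literature.NumberTheory.EllipticCurves.ModularForms.cuspHeckeOperatorₗ (CongruenceSubgroup.Gamma0 (W.conductorNorm ℤ * M)) 2 (Literature.NumberTheory.EllipticCurves.ModularForms.slToGLPos ModularGroup.S * Literature.NumberTheory.EllipticCurves.ModularForms.diagGL ((W.conductorNorm ℤ * M : ℕ) : ℚ) 1 (Nat.cast_pos.mpr (NeZero.pos (W.conductorNorm ℤ * M))) one_pos) g = -g ∧ (∀ (ℓ : ℕ) (hℓ : ℓ.Prime) (hℓL : ¬ ℓ ∣ W.conductorNorm ℤ * M), φ ⟨Literature.NumberTheory.EllipticCurves.ModularForms.heckeEigenvalue g ℓ, hR ℓ hℓ hℓL⟩ = ((W.frobeniusTrace ℓ : ℤ) : ZMod (p ^ n))) ∧ ∃ Λ : ℂ → ℂ, Differentiable ℂ Λ ∧ (∀ s : ℂ, 2 < s.re → Λ s = LSeries (fun m ↦ (UpperHalfPlane.qExpansion 1 ⇑g).coeff m) s) ∧ Λ 1 = 0 := by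
  sorry

/-- **Stub F_irr_red — finitely many IRRATIONAL accidental zeros at ONE depth on the Eisenstein sector
(OPEN, as crux #2's F_irr).** For `W/ℚ` globally minimal elliptic and `p ≥ 5` good ordinary with `E[p]`
reducible there is a depth `n` at which the pairs `(M, g)` — `M` squarefree coprime to `p·N_W`,
`g ∈ S₂(Γ₀(N_W·M))` a newform (`IsNewform0`) whose `q`-expansion is NOT integral (some coefficient is not
a rational integer) and `≠ (aₘ(W))ₘ`, Fricke `w g = -g`, depth-`n` congruent to `W` at the primes
`ℓ ∤ N_W·M` through a ring map `φ : R → ℤ/pⁿ`, `R ⊆ ℂ` a subring containing these `a_ℓ(g)`, and with an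
entire continuation of `L(g,s)` vanishing at `s = 1` — is FINITE. Why plausibly true: beyond the
Eisenstein depth a depth-`n` congruence to `f_W` is a cuspidal non-Eisenstein condition and the
heuristics of crux #2 apply unchanged (Galois-orbit rigidity of central vanishing, Shimura 1977; orbit
growth with the level; positive-proportion even-sign non-vanishing, Iwaniec–Sarnak); data: crux #2's
depth census (kit j024613–j024616: 0 central zeros among 21 even-sign congruent orbits of dimension ≤ 40)
and the strategist's survey j024220 (no depth-≥ 2 congruence to 11a1 mod 5 at levels `11·M`, `M ≤ 60`);
a reducible-sector depth-2 census is kit j025569/j025570 (lead c4). Why it might fail: it is a NEW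
non-vanishing / finiteness conjecture in the squarefree-level aspect, exactly as crux #2's F_irr; at
depth `≤ e(W,p)` members are abundant, so `n > e` necessarily. Size: XL (open). [cite: Shimura1977]
[cite: AtkinLehner1970, Thm. 4] -/
theorem stub_irrationalShadowsFiniteReducible : ∀ (W : WeierstrassCurve ℚ) [W.IsElliptic] [W.IsGloballyMinimal] (p : ℕ) [Fact p.Prime], 5 ≤ p → W.HasGoodReductionAtPrime p → ¬ (p : ℤ) ∣ W.frobeniusTrace p → ¬ W.HasIrreducibleModPGaloisRep p → ∃ n : ℕ, Set.Finite {x : Σ M : ℕ, CuspForm (CongruenceSubgroup.Gamma0 (W.conductorNorm ℤ * M)) 2 | ∃ (_ : NeZero (W.conductorNorm ℤ * x.1)) (R : Subring ℂ) (φ : R →+* ZMod (p ^ n)) (hR : ∀ ℓ : ℕ, ℓ.Prime → ¬ ℓ ∣ W.conductorNorm ℤ * x.1 → Literature.NumberTheory.EllipticCurves.ModularForms.heckeEigenvalue x.2 ℓ ∈ R), ¬ (∀ m : ℕ, ∃ a : ℤ, (UpperHalfPlane.qExpansion 1 ⇑(x.2)).coeff m = (a : ℂ)) ∧ Squarefree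 x.1 ∧ Nat.Coprime x.1 (p * W.conductorNorm ℤ) ∧ Literature.NumberTheory.EllipticCurves.ModularForms.IsNewform0 x.2 ∧ (∃ m : ℕ, (UpperHalfPlane.qExpansion 1 ⇑(x.2)).coeff m ≠ ((W.LFunction m : ℤ) : ℂ)) ∧ Literature.NumberTheory.EllipticCurves.ModularForms.cuspHeckeOperatorₗ (CongruenceSubgroup.Gamma0 (W.conductorNorm ℤ * x.1)) 2 (Literature.NumberTheory.EllipticCurves.ModularForms.slToGLPos ModularGroup.S * Literature.NumberTheory.EllipticCurves.ModularForms.diagGL ((W.conductorNorm ℤ * x.1 : ℕ) : ℚ) 1 (Nat.cast_pos.mpr (NeZero.pos (W.conductorNorm ℤ * x.1))) one_pos) x.2 = -(x.2) ∧ (∀ (ℓ : ℕ) (hℓ : ℓ.Prime) (hℓL : ¬ ℓ ∣ W.conductorNorm ℤ * x.1), φ ⟨Literature.NumberTheory.EllipticCurves.ModularForms.heckeEigenvalue x.2 ℓ, hR ℓ hℓ hℓL⟩ = ((W.frobeniusTrace ℓ : ℤ) : ZMod (p ^ n))) ∧ ∃ Λ : ℂ → ℂ, Differentiable ℂ Λ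 ∧ (∀ s : ℂ, 2 < s.re → Λ s = LSeries (fun m ↦ (UpperHalfPlane.qExpansion 1 ⇑(x.2)).coeff m) s) ∧ Λ 1 = 0} := by
  sorry

/-- **Stub DC_red — deep-congruence finiteness on the Eisenstein sector (TRUE ON PAPER, unformalised).**
For `W/ℚ` globally minimal elliptic and `p ≥ 5` good ordinary with `E[p]` reducible there is a depth `n`
such that the `L`-coefficient systems `(aₘ(E'))ₘ` of elliptic curves `E'/ℚ` with `pⁿ ∣ aℓ(E') − aℓ(W)`
for all but finitely many primes `ℓ` form a FINITE set. Proof on paper (lead c4, evidence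
`FRed-analysis.md` v2; no reference known): `n = 2`. Write `ρ̄_W^ss = ψ₁ ⊕ ψ₂`, `ψ₁ψ₂ = ω`,
`χ = ψ₁ψ₂⁻¹`; good ORDINARY reduction gives `χ|_{I_p} = ω^{±1}`, so `χ² ≠ 1`. Chebotarev makes
`tr ρ_{E',p²} = tr ρ_{W,p²}` on `G_ℚ`. (A) If `tr ρ_{W,p²}` is a sum of two characters (e.g. `W = X₀(11)`,
`p = 5`, split `E[5]`), the Bellaïche–Chenevier reducibility ideal forces `E'[p]` split or a rational
cyclic `p²`-isogeny, with the diagonal characters mod `p²` pinned to `W`'s, so a `p`-power-isogenous curve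
of `E'` is a `ℚ`-point of a fixed twist of `X₁(p²)`. (B) Otherwise, on `H₀ = ker ψ₁ ∩ ker ψ₂` the traces
read `2 + p(κ + γ'c')`, so `γ'c' = γ_W c_W` as products of additive characters of `H₀`; kernel matching
and `χ² ≠ 1` give `E'[p] ≅ W[p]` (up to a `p`-isogeny), then `ρ_{E',p²} = ρ_{W,p²}(1 + pY)` with
`tr(ρ̄Y) = 0` forces `Y = y₁₂E₁₂`, i.e. `E'` is a `ℚ`-point of a fixed twist of `X(p²)/{1 + p b E₁₂}`,
which covers `X₁(p²)`. Both have genus `≥ 12` (`X₁(25)`: 12, `X₁(49)`: 69), and Faltings' theorem gives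
finiteness. Formalisation needs mod-`p²` Galois representations of elliptic curves over `ℚ`, the modular
curves `X₁(p²)` / `X(p²)/Γ̄` with their twists, and Faltings — XL. [cite: Faltings1983Endlichkeit, Satz 7]
[cite: Mazur1989Deforming, §1.8 Prop. (Carayol)] [cite: CremonaFreitas2021, §1.1] -/
theorem stub_deepCongruenceFiniteReducible : ∀ (W : WeierstrassCurve ℚ) [W.IsElliptic] [W.IsGloballyMinimal] (p : ℕ) [Fact p.Prime], 5 ≤ p → W.HasGoodReductionAtPrime p → ¬ (p : ℤ) ∣ W.frobeniusTrace p → ¬ W.HasIrreducibleModPGaloisRep p → ∃ n : ℕ, Set.Finite {a : ℕ → ℤ | ∃ (W' : WeierstrassCurve ℚ) (_ : W'.IsElliptic), (∀ m : ℕ, a m = W'.LFunction m) ∧ {ℓ : ℕ | ℓ.Prime ∧ ¬ ((p : ℤ) ^ n ∣ W'.LFunction ℓ - W.LFunction ℓ)}.Finite} := by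
  sorry

/-- **Stub X_mod — modularity (named fact, never briefed).** The Modularity Theorem with level =
conductor, existence half: every elliptic `W/ℚ` has a newform `f ∈ S₂(Γ₀(N_W))` with `aₘ(f) = aₘ(W)`
(Breuil–Conrad–Diamond–Taylor 2001, Thm. A; Carayol 1986; Diamond–Shurman Thm. 8.8.3). It is the
Literature named fact `Literature.NumberTheory.EllipticCurves.ModularForms.exists_isNewformOf`
(unproved in the tree, size XL); consumed only by depth rigidity K in the branch "all `a_ℓ` agree".
[cite: BreuilConradDiamondTaylor2001, Thm. A] [cite: DiamondShurman2005, Thm. 8.8.3] -/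
theorem stub_modularity : Literature.NumberTheory.EllipticCurves.ModularForms.exists_isNewformOf := by
  sorry

/-- **Stub X_ES — the Eichler–Shimura construction (named fact, never briefed).** A weight-2 newform on
`Γ₀(N)` with integral `q`-expansion is the newform of an elliptic curve over `ℚ` (Knapp 1993, Thm. 11.74,
with Carayol for the level; Diamond–Shurman §6.6). It is the Literature named fact
`Literature.NumberTheory.EllipticCurves.ModularForms.eichlerShimuraConstruction` (unproved in the tree,
size XL); consumed only by F_rat_red. [cite: Knapp1993, Thm. 11.74 and Thm. 12.8] -/
theorem stub_eichlerShimura : Literature.NumberTheory.EllipticCurves.ModularForms.eichlerShimuraConstruction := by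
  sorry

/-! ## §3 Composition: the crux from the stubs (real proofs; `sorry` enters only through the stubs) -/

/-- **F_red from its two sectors (lead c4, v3).** The Eichler–Shimura construction, DC_red and F_irr_red
imply F_red: at the depth `n₁ = max n_rat n_irr` every accidental-zero datum `(M, g)` either has an
integral `q`-expansion — then, reducing its congruence to depth `n_rat` (`ZMod.castHom`) and dropping the
mismatch / Fricke / vanishing conjuncts, it lies in the finite set of
`Theorems.finiteRationalShadowsReducible_of_deepCongruenceFiniteReducible` (p156592) — or it does not,
and then it lies in the finite set of F_irr_red at depth `n_irr`. [folklore] -/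
theorem finiteShadowsAtOneDepthReducible_of : Sig.stub_eichlerShimura →
    Sig.stub_deepCongruenceFiniteReducible → Sig.stub_irrationalShadowsFiniteReducible →
    Sig.finiteShadowsAtOneDepthReducible := by
  intro hES hDC hFi W _ _ p _ h5 hgood hord hred
  classical
  obtain ⟨nr, hr⟩ :=
    Summit.BirchSwinnertonDyer.BirchSwinnertonDyer.Theorems.finiteRationalShadowsReducible_of_deepCongruenceFiniteReducible
      hES hDC W p h5 hgood hord hred
  obtain ⟨ni, hi⟩ := hFi W p h5 hgood hord hred
  refine ⟨max nr ni, (hr.union hi).subset ?_⟩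
  rintro ⟨M, g⟩ ⟨hM, R, φ, hR, hsq, hcop, hnew, hmis, hfr, hcong, hΛ⟩
  simp only [Set.mem_union, Set.mem_setOf_eq]
  by_cases hrat : ∀ m : ℕ, ∃ a : ℤ, (UpperHalfPlane.qExpansion 1 ⇑g).coeff m = (a : ℂ)
  · refine Or.inl ⟨hM, R, (ZMod.castHom (pow_dvd_pow p (le_max_left nr ni)) (ZMod (p ^ nr))).comp φ,
      hR, hrat, hsq, hcop, hnew, ?_⟩
    intro ℓ hℓ hℓL
    rw [RingHom.comp_apply, hcong ℓ hℓ hℓL, map_intCast]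
  · refine Or.inr ⟨hM, R, (ZMod.castHom (pow_dvd_pow p (le_max_right nr ni)) (ZMod (p ^ ni))).comp φ,
      hR, hrat, hsq, hcop, hnew, hmis, hfr, ?_, hΛ⟩
    intro ℓ hℓ hℓL
    rw [RingHom.comp_apply, hcong ℓ hℓ hℓL, map_intCast]

/-- **The compactness cut of I_red (lead c4; the reducible-sector twin of `Theorems.stub_transfer`).**
Modularity and F_red imply I_red: write `A n` for the set of depth-`n` accidental-zero data; `A n ⊆ A m`
for `m ≤ n` (compose `φ` with `ZMod (p^n) → ZMod (p^m)`); at the depth `n₁` of F_red the set `A n₁` is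
finite; each member dies at some depth by depth rigidity K (`Theorems.stub_depthRigidity`, a tree theorem
with no hypothesis on the sector, given modularity); beyond the maximum of `n₁` and these finitely many
death depths nothing survives, since a deeper datum restricts to a member of `A n₁` still alive at that
depth. [cite: AtkinLehner1970, Thm. 4] -/
theorem isolationReducible_of : Literature.NumberTheory.EllipticCurves.ModularForms.exists_isNewformOf →
    Sig.finiteShadowsAtOneDepthReducible → Sig.isolationReducible := by
  intro hMod hF W _ _ p _ h5 hgood hord hred
  classical
  -- the depth-`n` accidental-zero sets `A n`, bound locally together with their membership characterisation
  obtain ⟨A, hA⟩ : ∃ A : ℕ → Set (Σ M : ℕ, CuspForm (CongruenceSubgroup.Gamma0 (W.conductorNorm ℤ * M)) 2),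
      ∀ (n : ℕ) (x : Σ M : ℕ, CuspForm (CongruenceSubgroup.Gamma0 (W.conductorNorm ℤ * M)) 2), x ∈ A n ↔
        ∃ (_ : NeZero (W.conductorNorm ℤ * x.1)) (R : Subring ℂ) (φ : R →+* ZMod (p ^ n)) (hR : ∀ ℓ : ℕ, ℓ.Prime → ¬ ℓ ∣ W.conductorNorm ℤ * x.1 → Literature.NumberTheory.EllipticCurves.ModularForms.heckeEigenvalue x.2 ℓ ∈ R), Squarefree x.1 ∧ Nat.Coprime x.1 (p * W.conductorNorm ℤ) ∧ Literature.NumberTheory.EllipticCurves.ModularForms.IsNewform0 x.2 ∧ (∃ m : ℕ, (UpperHalfPlane.qExpansion 1 ⇑(x.2)).coeff m ≠ ((W.LFunction m : ℤ) : ℂ)) ∧ Literature.NumberTheory.EllipticCurves.ModularForms.cuspHeckeOperatorₗ (CongruenceSubgroup.Gamma0 (W.conductorNorm ℤ * x.1)) 2 (Literature.NumberTheory.EllipticCurves.ModularForms.slToGLPos ModularGroup.S * Literature.NumberTheory.EllipticCurves.ModularForms.diagGL ((W.conductorNorm ℤ * x.1 : ℕ) : ℚ) 1 (Nat.cast_pos.mpr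 (NeZero.pos (W.conductorNorm ℤ * x.1))) one_pos) x.2 = -(x.2) ∧ (∀ (ℓ : ℕ) (hℓ : ℓ.Prime) (hℓL : ¬ ℓ ∣ W.conductorNorm ℤ * x.1), φ ⟨Literature.NumberTheory.EllipticCurves.ModularForms.heckeEigenvalue x.2 ℓ, hR ℓ hℓ hℓL⟩ = ((W.frobeniusTrace ℓ : ℤ) : ZMod (p ^ n))) ∧ ∃ Λ : ℂ → ℂ, Differentiable ℂ Λ ∧ (∀ s : ℂ, 2 < s.re → Λ s = LSeries (fun m ↦ (UpperHalfPlane.qExpansion 1 ⇑(x.2)).coeff m) s) ∧ Λ 1 = 0 :=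
    ⟨fun n ↦ {x | _}, fun _ _ ↦ Iff.rfl⟩
  -- `A n ⊆ A m` for `m ≤ n`: reduce the congruence modulo `p ^ m`
  have anti : ∀ {m n : ℕ}, m ≤ n → A n ⊆ A m := by
    intro m n hmn x hx
    obtain ⟨hM, R, φ, hR, hsq, hcop, hnew, hmis, hfr, hcong, hΛ⟩ := (hA n x).1 hx
    refine (hA m x).2 ⟨hM, R, (ZMod.castHom (pow_dvd_pow p hmn) (ZMod (p ^ m))).comp φ, hR, hsq, hcop,
      hnew, hmis, hfr, ?_, hΛ⟩
    intro ℓ hℓ hℓL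
    rw [RingHom.comp_apply, hcong ℓ hℓ hℓL, map_intCast]
  obtain ⟨n₁, hn₁⟩ := hF W p h5 hgood hord hred
  -- (1) `A n₁` is finite: it is the finite set of F_red
  have hfin : (A n₁).Finite := by
    refine hn₁.subset ?_
    intro x hx
    exact (hA n₁ x).1 hx
  -- (2) every member of `A n₁` dies at some depth (K, given modularity)
  have hdie : ∀ x ∈ A n₁, ∃ n : ℕ, x ∉ A n := by
    rintro ⟨M, g⟩ hx
    obtain ⟨hM, R, φ, hR, -, -, hnew, hmis, -, -, -⟩ := (hA n₁ _).1 hx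
    haveI := hM
    obtain ⟨n, hn⟩ :=
      Summit.BirchSwinnertonDyer.BirchSwinnertonDyer.Theorems.stub_depthRigidity hMod W p M g hnew hmis
    refine ⟨n, fun hx' ↦ ?_⟩
    obtain ⟨_, R', φ', hR', -, -, -, -, -, hcong', -⟩ := (hA n _).1 hx'
    exact hn R' φ' hR' hcong'
  choose! f hf using hdie
  -- (3) the uniform depth: beyond `n₁` and every death depth of the finitely many members of `A n₁`
  refine ⟨max n₁ (hfin.toFinset.sup f), fun n hn ↦ ?_⟩
  rintro ⟨M, hM, g, R, φ, hR, hrest⟩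
  have hx : (⟨M, g⟩ : Σ M : ℕ, CuspForm (CongruenceSubgroup.Gamma0 (W.conductorNorm ℤ * M)) 2) ∈ A n :=
    (hA n _).2 ⟨hM, R, φ, hR, hrest⟩
  have hx₁ : (⟨M, g⟩ : Σ M : ℕ, CuspForm (CongruenceSubgroup.Gamma0 (W.conductorNorm ℤ * M)) 2) ∈ A n₁ :=
    anti ((le_max_left _ _).trans hn) hx
  have hle : f ⟨M, g⟩ ≤ n :=
    (Finset.le_sup (f := f) (hfin.mem_toFinset.mpr hx₁)).trans ((le_max_right _ _).trans hn)
  exact hf _ hx₁ (anti hle hx)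

/-- **Converse of the cut (for the record): I_red implies F_red** — at the isolation depth `n₀` the
accidental-zero set is EMPTY, a fortiori finite; so, given modularity, F_red and I_red are equivalent and
the reshape loses nothing. [folklore] -/
theorem finiteShadowsAtOneDepthReducible_of_isolationReducible :
    Sig.isolationReducible → Sig.finiteShadowsAtOneDepthReducible := by
  intro hI W _ _ p _ h5 hgood hord hred
  obtain ⟨n₀, hn₀⟩ := hI W p h5 hgood hord hred
  refine ⟨n₀, ?_⟩
  convert Set.finite_empty
  ext x
  simp only [Set.mem_setOf_eq, Set.mem_empty_iff_false, iff_false]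
  rintro ⟨hM, R, φ, hR, hrest⟩
  exact hn₀ n₀ le_rfl ⟨x.1, hM, x.2, R, φ, hR, hrest⟩

/-- **Composition, arithmetic core (line `eisenstein-shadow`).** `Sig.stub_shadowBeyondEisensteinDepth →
Sig.isolationReducible →` the crux UNFOLDED (so that the first theorem concluding the crux BY NAME below is
the one over the registered stubs): if `corank_{ℤ_p} Ш(W)[p^∞] ≠ 0`
then `Ш(W)` has classes of every exact order `p^n` — steps (A) "a finite group has corank formula `0`"
and (B) "bounded exponent + finite `p`-torsion ⇒ finite" VERBATIM from the route's `closes` (support item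
`ShaUnboundedOfCorank`, Greenberg LNM 1716 §1) — so S_red yields an accidental zero at depth
`max n₀ 1 ≥ n₀` from a class of order `p^(max n₀ 1 + e)`, contradicting I_red. No `sorry` of its own;
`#print axioms` = `propext`, `Classical.choice`, `Quot.sound`. [cite: Greenberg1999LNM, §1 pp. 54–57] -/
theorem shaCorank_eq_zero_of_shadow_of_isolation : Sig.stub_shadowBeyondEisensteinDepth →
    Sig.isolationReducible →
    ∀ (W : WeierstrassCurve ℚ) [W.IsElliptic] [W.IsGloballyMinimal] (p : ℕ) [Fact p.Prime], 5 ≤ p →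
      W.HasGoodReductionAtPrime p → ¬ (p : ℤ) ∣ W.frobeniusTrace p → ¬ W.HasIrreducibleModPGaloisRep p →
      W.shaCorank p = 0 := by
  intro hS hI
  classical
  -- (A)+(B): support item `ShaUnboundedOfCorank` of the route, PROVED inline exactly as in `closes`
  have hzero : ∀ (B : Type) [AddCommGroup B] [Finite B] (p : ℕ) [Fact p.Prime],
      Literature.NumberTheory.EllipticCurves.zpCorank B p = 0 := by
    intro B _ _ p hp
    unfold Literature.NumberTheory.EllipticCurves.zpCorank
    letI : Module (ZMod p) (AddSubgroup.torsionBy B (p : ℤ)) := AddSubgroup.torsionBy.zmodModule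
    set φ : B →+ B := zsmulAddGroupHom (p : ℤ) with hφ
    have hker : ∀ x, x ∈ φ.ker ↔ x ∈ AddSubgroup.torsionBy B (p : ℤ) := by
      intro x
      simp [hφ, AddMonoidHom.mem_ker, Submodule.mem_torsionBy_iff]
    have hrange : ∀ x, x ∈ φ.range ↔
        x ∈ (LinearMap.range (LinearMap.lsmul ℤ B p)).toAddSubgroup := by
      intro x
      simp [hφ, AddMonoidHom.mem_range, LinearMap.mem_range]
    have hkerEq : φ.ker = AddSubgroup.torsionBy B (p : ℤ) := AddSubgroup.ext hker
    have hrangeEq : φ.range = (LinearMap.range (LinearMap.lsmul ℤ B p)).toAddSubgroup :=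
      AddSubgroup.ext hrange
    have h1 : Nat.card B = Nat.card (B ⧸ φ.ker) * Nat.card φ.ker :=
      AddSubgroup.card_eq_card_quotient_mul_card_addSubgroup _
    have h2 : Nat.card (B ⧸ φ.ker) = Nat.card φ.range :=
      Nat.card_congr (QuotientAddGroup.quotientKerEquivRange φ).toEquiv
    have h3 : Nat.card B = Nat.card (B ⧸ φ.range) * Nat.card φ.range :=
      AddSubgroup.card_eq_card_quotient_mul_card_addSubgroup _
    have hpos : 0 < Nat.card φ.range := Nat.card_pos
    have hcard : Nat.card φ.ker = Nat.card (B ⧸ φ.range) := by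
      rw [h2] at h1
      have h13 := h1.symm.trans h3
      rw [mul_comm] at h13
      exact Nat.eq_of_mul_eq_mul_right hpos h13
    have hcardK : Nat.card (AddSubgroup.torsionBy B (p : ℤ)) = Nat.card (ModN B p) := by
      rw [← hkerEq, hcard, hrangeEq]
      rfl
    haveI : Module.Finite (ZMod p) (AddSubgroup.torsionBy B (p : ℤ)) := Module.Finite.of_finite
    haveI : Finite (ModN B p) :=
      Finite.of_surjective _ (Submodule.mkQ_surjective (LinearMap.range (LinearMap.lsmul ℤ B p)))
    haveI : Module.Finite (ZMod p) (ModN B p) := Module.Finite.of_finite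
    have e1 := Module.natCard_eq_pow_finrank (K := ZMod p) (V := AddSubgroup.torsionBy B (p : ℤ))
    have e2 := Module.natCard_eq_pow_finrank (K := ZMod p) (V := ModN B p)
    rw [Nat.card_zmod] at e1 e2
    have : Module.finrank (ZMod p) (AddSubgroup.torsionBy B (p : ℤ)) =
        Module.finrank (ZMod p) (ModN B p) :=
      Nat.pow_right_injective hp.out.two_le (e1.symm.trans (hcardK.trans e2))
    omega
  have hAlg : ShaUnboundedOfCorank := by
    intro W _ p hp hcor n
    have hpp : p.Prime := hp.out
    by_contra hno
    push Not at hno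
    apply hcor
    -- the `p`-primary part `A = Ш[p^∞]` of `Ш(W)`
    set A : AddSubgroup ↥W.sha := AddCommGroup.primaryComponent (↥W.sha) p
    show Literature.NumberTheory.EllipticCurves.zpCorank (↥A) p = 0
    -- (B1) `p ^ n` kills `A`: an element of order `p ^ m`, `m ≥ n`, would have a multiple of exact order `p ^ n`
    have hkill : ∀ a : ↥A, p ^ n • a = 0 := by
      intro a
      obtain ⟨k, hk⟩ : ∃ k : ℕ, p ^ k • (a : ↥W.sha) = 0 := a.2
      have hdvd : addOrderOf (a : ↥W.sha) ∣ p ^ k := addOrderOf_dvd_of_nsmul_eq_zero hk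
      obtain ⟨m, -, hm⟩ := (Nat.dvd_prime_pow hpp).1 hdvd
      by_cases hmn : n ≤ m
      · exfalso
        have hne : addOrderOf (a : ↥W.sha) ≠ 0 := by rw [hm]; exact pow_ne_zero _ hpp.ne_zero
        have hdiv : p ^ n ∣ addOrderOf (a : ↥W.sha) := by rw [hm]; exact pow_dvd_pow p hmn
        exact hno _ (addOrderOf_nsmul_addOrderOf_sub hne hdiv)
      · push Not at hmn
        have hdiv : addOrderOf (a : ↥W.sha) ∣ p ^ n := by rw [hm]; exact pow_dvd_pow p hmn.le
        apply Subtype.ext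
        rw [AddSubgroupClass.coe_nsmul, ZeroMemClass.coe_zero]
        exact addOrderOf_dvd_iff_nsmul_eq_zero.mp hdiv
    -- (B2) `A[p]` is finite: otherwise its `finrank` is the junk value `0` and the corank formula is `0`
    haveI hfinp : Finite ↥(AddSubgroup.torsionBy (↥A) (p : ℤ)) := by
      by_contra hinf
      apply hcor
      show Literature.NumberTheory.EllipticCurves.zpCorank (↥A) p = 0
      unfold Literature.NumberTheory.EllipticCurves.zpCorank
      letI : Module (ZMod p) (AddSubgroup.torsionBy (↥A) (p : ℤ)) := AddSubgroup.torsionBy.zmodModule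
      have h0 : Module.finrank (ZMod p) (AddSubgroup.torsionBy (↥A) (p : ℤ)) = 0 := by
        apply Module.finrank_of_not_finite
        intro hf
        exact hinf (Module.finite_of_finite (ZMod p))
      rw [h0, Nat.zero_sub]
    -- (B3) hence `A = A[p^n]` is finite and (A) applies
    haveI : Finite ↥(AddSubgroup.torsionBy (↥A) ((p ^ n : ℕ) : ℤ)) :=
      Literature.NumberTheory.EllipticCurves.finite_torsionBy_pow (↥A) p n
    haveI : Finite ↥A :=
      Finite.of_injective
        (fun a : ↥A => (⟨a, AddSubgroup.torsionBy.nsmul_iff.mpr (hkill a)⟩ :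
          ↥(AddSubgroup.torsionBy (↥A) ((p ^ n : ℕ) : ℤ))))
        (fun a b h => by simpa using congrArg Subtype.val h)
    exact hzero (↥A) p
  -- the contrapositive on the Eisenstein sector
  intro W _ _ p _ h5 hgood hord hred
  by_contra hne
  obtain ⟨e, he⟩ := hS W p h5 hgood hord hred
  obtain ⟨n₀, hn₀⟩ := hI W p h5 hgood hord hred
  obtain ⟨σ, hσ⟩ := hAlg W p hne (max n₀ 1 + e)
  exact hn₀ (max n₀ 1) (le_max_left _ _) (he (max n₀ 1) (le_max_right _ _) ⟨σ, hσ⟩)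

/-- **Composition from the registered stubs (lead c4, v3; the theorem the skeleton audit keys on).**
S_red, modularity, Eichler–Shimura, DC_red and F_irr_red imply the crux BY NAME:
`finiteShadowsAtOneDepthReducible_of` gives F_red, `isolationReducible_of` gives I_red, and
`shaCorank_eq_zero_of_shadow_of_isolation` concludes. Real proof; `#print axioms` = `propext`,
`Classical.choice`, `Quot.sound`. [folklore] -/
theorem ShaCotorsionReducible_of_stubs : Sig.stub_shadowBeyondEisensteinDepth → Sig.stub_modularity →
    Sig.stub_eichlerShimura → Sig.stub_deepCongruenceFiniteReducible →
    Sig.stub_irrationalShadowsFiniteReducible →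
    Summit.BirchSwinnertonDyer.BirchSwinnertonDyer.Theses.ShadowIsolation.ShaCotorsionReducible :=
  fun hS hMod hES hDC hFi W _ _ p _ h5 hgood hord hred ↦
    shaCorank_eq_zero_of_shadow_of_isolation hS
      (isolationReducible_of hMod (finiteShadowsAtOneDepthReducible_of hES hDC hFi)) W p h5 hgood hord hred

/-- Sanity link: the converse cut is part of the line's bookkeeping (kept referenced so the audit does
not read it as an orphan of this file): given modularity, F_red and I_red are equivalent. [folklore] -/
theorem isolationReducible_iff (hMod : Sig.stub_modularity) :
    Sig.isolationReducible ↔ Sig.finiteShadowsAtOneDepthReducible :=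
  ⟨finiteShadowsAtOneDepthReducible_of_isolationReducible, isolationReducible_of hMod⟩

/-- **Registered target.** The crux decl from the five stubs through `ShaCotorsionReducible_of_stubs`
(concludes `…Theses.ShadowIsolation.ShaCotorsionReducible` BY NAME; closed = false, its closure reaches
`sorryAx` exactly through `stub_shadowBeyondEisensteinDepth`, `stub_modularity`, `stub_eichlerShimura`,
`stub_deepCongruenceFiniteReducible` and `stub_irrationalShadowsFiniteReducible`). -/
theorem ShaCotorsionReducible_skeleton :
    Summit.BirchSwinnertonDyer.BirchSwinnertonDyer.Theses.ShadowIsolation.ShaCotorsionReducible :=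
  ShaCotorsionReducible_of_stubs stub_shadowBeyondEisensteinDepth stub_modularity stub_eichlerShimura
    stub_deepCongruenceFiniteReducible stub_irrationalShadowsFiniteReducible

end Summit.BirchSwinnertonDyer.BirchSwinnertonDyer.Cruxes.ShaCotorsionReducible.EisensteinShadow
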